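/-
Copyright (c) 2026 the pub-hodgecm-mathlib formalisation cell (harness21).  Prover seat hodgecm-mathlib-K2Liu-p12 (g0): Track B «K2-LIT»,
#184♮ = hLiu418 = stmt-HodgeConjecture-24832; Road Φ of socket #41, organ Φ4 «unramified local coefficient» (LEAD F0P6-plan (g13) ruling «M-157k»), file U2.
-/
import Summits.HodgeConjecture.HodgeConjecture.Theorems.K2LiuSiegelWeylUnipotentIwasawa     -- ★ `IsIntegralAt` API, `isIntegralAt_matA_weylDelta`, `adapt_matA_pElem`
import Summits.HodgeConjecture.HodgeConjecture.Theorems.K2LiuSiegelLeviWeylAlgebra          -- ★ `detDelta_levi`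
import Summits.HodgeConjecture.HodgeConjecture.Theorems.K2LiuLocalSiegelIwasawa             -- ★ O41.5 (4b): `exists_isSiegelDelta_mul_mem_localInt`
import Summits.HodgeConjecture.HodgeConjecture.Theorems.K2LiuSiegelSectionNorm              -- ★ `norm_chiDet_eq_one`
import Literature.NumberTheory.Automorphic.GLnCongruenceSubgroups                          -- ★ `valuation_det_le_one`
import Literature.NumberTheory.Automorphic.ValuedFieldValuativeRelBridge                   -- ★ `v_le_one_iff_valuation_le_one`
import HarnessLib

/-!
# Crux `HLiu418`, Road Φ of socket #41, organ Φ4 — FILE U2: THE CONTENT BOUND `|det_Δ p(w_Δ n(X))|_v ≤ 1` AND THE SPHERICAL SUP BOUND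

Cell `hodgecm-mathlib`, crux item hLiu418 = `stmt-HodgeConjecture-24832`, route of record `HCCMUnconditional`; squad K2 ∕ K2Liu, road `K2_Liu`,
socket #41 `sig_K2LiuSiegelEisensteinContinuation`, Road Φ, organ Φ4 = «(R-bound) + the one exact value» (ruling M-157k; census
`K2/K2Liu-p12/g0/CENSUS-PHI4-UnramifiedLocalCoefficient.K2Liu-p12-g0.md` §1 (U2)).  THEOREMS ONLY (no `def`, no `instance`, no `notation`, no
named-fact hypothesis, no `sorry`); lane `--supports stmt-HodgeConjecture-24832` (count-neutral helper; closes no socket by itself).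

THE ARGUMENT (no Smith form, no minors).  At a good place (`|2|_w = 1`, `T₀`, `T₀⁻¹` integral) every `g ∈ H(F_v)` factors `g = p·k`, `p ∈ P_Δ(F_v)`,
`k ∈ K_v = H(𝒪_v)` (★ `exists_isSiegelDelta_mul_mem_localInt`).  In the `Δ`-adapted frame `p = g k⁻¹` reads blockwise
  `A(p) = A(g)·A(k⁻¹) + B(g)·C(k⁻¹)`     (★ `blkA_mul`),
and `k⁻¹ ∈ K_v` has an integral adapted matrix (`isIntegralAt_matA_of_mem_localInt'`, every `w ∣ v`), hence integral blocks (`|2|_w = 1`).  So whenever the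
blocks `A(g)`, `B(g)` are integral, `A(p)` is integral and `|det_Δ p|_w = |det A(p)|_w ≤ 1` (★ `detDelta_levi`, ★ `valuation_det_le_one`) — for EVERY Siegel
factor `p` of `g`.  For `g = w_Δ n(X)` the adapted matrix is `(0 1; 1 0)(1 X; 0 1) = (0 1; 1 X)`: `A(g) = 0`, `B(g) = 1`, integral WHATEVER `X` is.
Consequently a SPHERICAL section `φ` of `I_v(s, χ_v)` with `χ_v` unitary satisfies, for `Re s + n/2 ≥ 0` and every skew `X`,
  **`‖φ(w_Δ n(X))‖ = |det_Δ p|_v^{Re s + n/2} ≤ 1`**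
(`φ(pk) = χ_v(det_Δ p)|det_Δ p|_v^{s+n/2}`, ★ `IsSphericalSection.apply_siegel_mul_localInt`).  This is the `v`-UNIFORM sup bound of the integrand of the
unramified Whittaker coefficient on every ball `B(−K)`, the second input (after ★ U1∕U1′) of the (R-bound) face of organ Φ4.

## Main statements
* `isIntegralAt_matA_of_mem_localInt'` — `k ∈ K_v ⇒` the adapted matrix of `k` is integral at EVERY `w ∣ v` (★ had it at non-split `w` only).
* `valuation_detDelta_le_one_of_decomp` — `g = p k`, `p` Siegel, `k ∈ K_v`, `A(g)`, `B(g)` integral at `w`, `|2|_w = 1` ⇒ `v_w(det_Δ p) ≤ 1`.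
* `blkA_weylDelta_mul_nElem`, `blkB_weylDelta_mul_nElem` — `A(w_Δ n(X)) = 0`, `B(w_Δ n(X)) = 1`.
* `absDetDelta_le_one_of_weylDelta_mul_nElem_eq` — `w_Δ n(X) = p k ⇒ |det_Δ p|_v ≤ 1`.
* `norm_apply_weylDelta_mul_nElem_le_one` — the spherical sup bound.

## References
* [Casselman1980] W. Casselman, Compositio Math. 40 (1980), §3.   * [Shimura1997] G. Shimura, CBMS 93 (1997), §13, §18.
* [KudlaRallis1994] S. Kudla, S. Rallis, Ann. of Math. 140 (1994), §2.   * [HarrisKudlaSweet1996] M. Harris, S. Kudla, W. J. Sweet, J. AMS 9 (1996), §1 (1.11)–(1.15).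
-/

set_option autoImplicit false
-- the mandated namespace repeats the single-problem summit's segment (`HodgeConjecture.HodgeConjecture`)
set_option linter.dupNamespace false

noncomputable section

open scoped Matrix ValuativeRel
open NumberField IsDedekindDomain Matrix
open Literature.NumberTheory.Automorphic Literature.NumberTheory.Automorphic.UnitaryGroup
open Literature.NumberTheory.GelbartRogawski1991.AdaptedBlocks
open Literature.NumberTheory.GelbartRogawski1991.UnitaryDualPair.LocalSplitting
open Literature.NumberTheory.K2Lit.LocalSiegelDoubled
open Summit.HodgeConjecture.HodgeConjecture.Cruxes.HLiu418.K2LiuSiegelLeviWeylAlgebra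
open Summit.HodgeConjecture.HodgeConjecture.Cruxes.HLiu418.K2LiuSiegelWeylUnipotentIwasawa
open Summit.HodgeConjecture.HodgeConjecture.Cruxes.HLiu418.K2LiuLocalSiegelIwasawa
open Summit.HodgeConjecture.HodgeConjecture.Cruxes.HLiu418.K2LiuSiegelSectionNorm

namespace Summit.HodgeConjecture.HodgeConjecture.Cruxes.HLiu418.K2LiuSiegelWeylUnipotentContent

variable (F : Type) [Field F] [NumberField F] (E : Type) [Field E] [NumberField E] [Algebra F E]
  [Algebra.IsQuadraticExtension F E] (c : E ≃ₐ[F] E)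
  {δ : E} (hcδ : c δ = -δ) (hδ : δ ≠ 0) {dd : F} (hd : δ * δ = algebraMap F E dd)
  (v : HeightOneSpectrum (𝓞 F)) (n : ℕ) {T₀ : Matrix (Fin n) (Fin n) F} (hT₀ : T₀.IsSymm) (hT₀d : IsUnit T₀.det)
  {JD : Matrix (Fin (n + n)) (Fin (n + n)) E} (hJD : JD = (gramD F n T₀).map (algebraMap F E))

/-! ## §1 Integrality of `K_v` in the adapted frame, at every `w ∣ v` -/

omit [Algebra.IsQuadraticExtension F E] in
/-- **`k ∈ K_v = H(𝒪_v)` ⇒ the matrix of `k` over `E ⊗ F_v` is integral at every `w ∣ v`** (split or not; ★ `isIntegralAt_matA_of_mem_localInt` asked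
`c • w = w`). [cite: PlatonovRapinchuk1994, §5.1] -/
theorem isIntegralAt_matA_of_mem_localInt' {k : UnitaryGroup.localPi E c (n + n) JD v} (hk : k ∈ UnitaryGroup.localInt E c (n + n) JD v)
    (w : PlacesOver E v) : IsIntegralAt F E v w (matA F E c v n k) := by
  have h := ((mem_glInt_iff _).1 ((UnitaryGroup.mem_localInt_iff E c (n + n) JD v k).1 hk w)).1
  intro i j
  have hij := h (e₂ n i) (e₂ n j)
  rw [coe_component_eq_matS_map, Valuation.mem_integer_iff] at hij
  simpa only [matA, Matrix.map_apply, Matrix.reindex_apply, Equiv.symm_symm, Matrix.submatrix_apply] using hij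

omit [Algebra.IsQuadraticExtension F E] in
/-- the four adapted blocks of an integral matrix are integral when `|2|_w = 1`. [cite: Kudla1994, §3] -/
theorem isIntegralAt_blocks {M : Matrix (Fin n ⊕ Fin n) (Fin n ⊕ Fin n) (LocalRing E v)} (w : PlacesOver E v)
    (h2 : ValuativeRel.valuation (w.1.adicCompletion E) (2 : w.1.adicCompletion E) = 1) (hM : IsIntegralAt F E v w M) :
    IsIntegralAt F E v w (blkA M) ∧ IsIntegralAt F E v w (blkB M) ∧ IsIntegralAt F E v w (blkC M) ∧ IsIntegralAt F E v w (blkD M) := by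
  have h := (isIntegralAt_adapt F E v n w h2 hM).toBlocks
  rw [adapt_eq] at h
  simp only [Matrix.toBlocks_fromBlocks₁₁, Matrix.toBlocks_fromBlocks₂₂, Matrix.toBlocks_fromBlocks₁₂, Matrix.toBlocks_fromBlocks₂₁] at h
  exact ⟨h.1, fun i j => h.2.2.1 i j, fun i j => h.2.2.2 i j, h.2.1⟩

/-! ## §2 The content bound for a Siegel factor -/

include hcδ hδ hd hT₀ hJD in
/-- **`v_w(det_Δ p) ≤ 1` for every Siegel factor `p` of `g = p k` (`k ∈ K_v`) whose adapted blocks `A(g)`, `B(g)` are integral at `w`** (`|2|_w = 1`):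
`A(p) = A(g)A(k⁻¹) + B(g)C(k⁻¹)` is integral. [cite: Casselman1980, §3] [cite: Shimura1997, §13] -/
theorem valuation_detDelta_le_one_of_decomp {g p k : UnitaryGroup.localPi E c (n + n) JD v}
    (hp : IsSiegelDelta F E c hcδ hδ hd v n hT₀ hJD p) (hk : k ∈ UnitaryGroup.localInt E c (n + n) JD v) (hg : g = p * k)
    (w : PlacesOver E v) (h2 : ValuativeRel.valuation (w.1.adicCompletion E) (2 : w.1.adicCompletion E) = 1)
    (hA : IsIntegralAt F E v w (blkA (matA F E c v n g))) (hB : IsIntegralAt F E v w (blkB (matA F E c v n g))) :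
    ValuativeRel.valuation (w.1.adicCompletion E) (detDelta F E c v n w p) ≤ 1 := by
  have hC : blkC (matA F E c v n p) = 0 := (isSiegelDelta_iff_blkC_eq_zero F E c hcδ hδ hd v n hT₀ hJD p).1 hp
  have hpeq : p = g * k⁻¹ := by rw [hg, mul_inv_cancel_right]
  obtain ⟨hkA, -, hkC, -⟩ := isIntegralAt_blocks F E v n w h2 (isIntegralAt_matA_of_mem_localInt' F E c v n (Subgroup.inv_mem _ hk) w)
  have hAp : IsIntegralAt F E v w (blkA (matA F E c v n p)) := by
    rw [hpeq, ← matA_mul, blkA_mul]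
    exact (hA.mul hkA).add (hB.mul hkC)
  rw [detDelta_levi F E c v n hC w, show (blkA (matA F E c v n p)).det w =
      ((blkA (matA F E c v n p)).map (Pi.evalRingHom (fun w' : PlacesOver E v => w'.1.adicCompletion E) w)).det by
    rw [← RingHom.mapMatrix_apply, ← RingHom.map_det]; rfl]
  exact valuation_det_le_one hAp

/-! ## §3 `g = w_Δ n(X)`: `A(g) = 0`, `B(g) = 1` -/

include hJD in
omit [Algebra.IsQuadraticExtension F E] in
/-- the adapted matrix of `w_Δ n(X)` is `(0 1; 1 X)`. [cite: Kudla1994, §3] [cite: HarrisKudlaSweet1996, §1 (1.12)] -/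
theorem adapt_matA_weylDelta_mul_nElem (X : Matrix (Fin n) (Fin n) (LocalRing E v))
    (hX : (X.map (conjLocal E c v))ᵀ * gramS F E v n T₀ + gramS F E v n T₀ * X = 0) :
    adapt (matA F E c v n (weylDelta F E c v n hJD * nElem F E c v n hJD X hX)) = Matrix.fromBlocks 0 1 1 X := by
  rw [← matA_mul, adapt_mul, weylDelta, adapt_matA_ofAdapted, adapt_matA_nElem, Matrix.fromBlocks_multiply]
  simp only [Matrix.zero_mul, Matrix.one_mul, zero_add, add_zero, Matrix.mul_one, Matrix.mul_zero]

include hJD in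
omit [Algebra.IsQuadraticExtension F E] in
/-- `A(w_Δ n(X)) = 0` and `B(w_Δ n(X)) = 1`. [cite: Kudla1994, §3] -/
theorem blkA_blkB_weylDelta_mul_nElem (X : Matrix (Fin n) (Fin n) (LocalRing E v))
    (hX : (X.map (conjLocal E c v))ᵀ * gramS F E v n T₀ + gramS F E v n T₀ * X = 0) :
    blkA (matA F E c v n (weylDelta F E c v n hJD * nElem F E c v n hJD X hX)) = 0 ∧
      blkB (matA F E c v n (weylDelta F E c v n hJD * nElem F E c v n hJD X hX)) = 1 := by
  have h := adapt_matA_weylDelta_mul_nElem F E c v n hJD X hX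
  rw [adapt_eq] at h
  obtain ⟨h₁, h₂, -, -⟩ := Matrix.fromBlocks_inj.1 h
  exact ⟨h₁, h₂⟩

include hcδ hδ hd hT₀ hJD in
/-- **THE CONTENT BOUND: `|det_Δ p|_v ≤ 1` for every Iwasawa factorisation `w_Δ n(X) = p k`** (`p ∈ P_Δ(F_v)`, `k ∈ K_v`, `|2|_w = 1` for all `w ∣ v`),
together with `v_w(det_Δ p) ≤ 1` at each `w`.  Classically `|det_Δ p|_v^{-1} = [𝒪^n + X𝒪^n : 𝒪^n]` (the content of `X`).
[cite: Shimura1997, §13] [cite: KudlaRallis1994, §2] [cite: Casselman1980, §3] -/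
theorem absDetDelta_le_one_of_weylDelta_mul_nElem_eq (h2 : ∀ w : PlacesOver E v, ValuativeRel.valuation (w.1.adicCompletion E) (2 : w.1.adicCompletion E) = 1)
    (X : Matrix (Fin n) (Fin n) (LocalRing E v)) (hX : (X.map (conjLocal E c v))ᵀ * gramS F E v n T₀ + gramS F E v n T₀ * X = 0)
    {p k : UnitaryGroup.localPi E c (n + n) JD v} (hp : IsSiegelDelta F E c hcδ hδ hd v n hT₀ hJD p)
    (hk : k ∈ UnitaryGroup.localInt E c (n + n) JD v) (hg : weylDelta F E c v n hJD * nElem F E c v n hJD X hX = p * k) :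
    (∀ w : PlacesOver E v, ValuativeRel.valuation (w.1.adicCompletion E) (detDelta F E c v n w p) ≤ 1) ∧ absDetDelta F E c v n p ≤ 1 := by
  obtain ⟨hA0, hB1⟩ := blkA_blkB_weylDelta_mul_nElem F E c v n hJD X hX
  have hw : ∀ w : PlacesOver E v, ValuativeRel.valuation (w.1.adicCompletion E) (detDelta F E c v n w p) ≤ 1 := fun w =>
    valuation_detDelta_le_one_of_decomp F E c hcδ hδ hd v n hT₀ hJD hp hk hg w (h2 w) (by rw [hA0]; exact IsIntegralAt.zero)
      (by rw [hB1]; exact IsIntegralAt.one)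
  refine ⟨hw, ?_⟩
  unfold absDetDelta
  refine Finset.prod_le_one (fun w _ => norm_nonneg _) fun w _ => ?_
  have h1 : Valued.v (detDelta F E c v n w p) ≤ 1 := (v_le_one_iff_valuation_le_one _).2 (hw w)
  rw [NumberField.FinitePlace.norm_def]
  have h := (WithZeroMulInt.toNNReal_le_one_iff (HeightOneSpectrum.one_lt_absNorm_nnreal w.1)).2 h1
  exact_mod_cast h

/-! ## §4 The spherical sup bound -/

include hcδ hδ hd hT₀ hT₀d hJD in
/-- **THE SPHERICAL SUP BOUND.**  At a good place (`|2|_w = 1` for all `w ∣ v`, `T₀` and `T₀⁻¹` integral), for a spherical section `φ` of `I_v(s, χ_v)` (★ D10) with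
`χ_v` unitary and `Re s + n/2 ≥ 0`:  `‖φ(w_Δ n(X))‖ ≤ 1` for EVERY skew `X` — uniformly in `X`, in `v` and in `Im s`.
[cite: Casselman1980, §3] [cite: Shimura1997, §13, §18] [cite: KudlaRallis1994, §2] -/
theorem norm_apply_weylDelta_mul_nElem_le_one
    (h2 : ∀ w : PlacesOver E v, ValuativeRel.valuation (w.1.adicCompletion E) (2 : w.1.adicCompletion E) = 1)
    (hT : ∀ (w : PlacesOver E v) (i j : Fin n),
      ValuativeRel.valuation (w.1.adicCompletion E) (algebraMap E (w.1.adicCompletion E) (algebraMap F E (T₀ i j))) ≤ 1)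
    (hTinv : ∀ (w : PlacesOver E v) (i j : Fin n),
      ValuativeRel.valuation (w.1.adicCompletion E) (algebraMap E (w.1.adicCompletion E) (algebraMap F E (T₀⁻¹ i j))) ≤ 1)
    {χv : ∀ w : PlacesOver E v, (w.1.adicCompletion E)ˣ →* ℂˣ} (hχ1 : ∀ (w : PlacesOver E v) (x : (w.1.adicCompletion E)ˣ), ‖((χv w x : ℂˣ) : ℂ)‖ = 1)
    {s : ℂ} (hs : 0 ≤ s.re + (n : ℝ) / 2) {φ : UnitaryGroup.localPi E c (n + n) JD v → ℂ}
    (hφ : IsSphericalSection F E c hcδ hδ hd v n hT₀ hJD χv s φ)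
    (X : Matrix (Fin n) (Fin n) (LocalRing E v)) (hX : (X.map (conjLocal E c v))ᵀ * gramS F E v n T₀ + gramS F E v n T₀ * X = 0) :
    ‖φ (weylDelta F E c v n hJD * nElem F E c v n hJD X hX)‖ ≤ 1 := by
  obtain ⟨p, k, hp, hk, hg⟩ := exists_isSiegelDelta_mul_mem_localInt F E c hcδ hδ hd v n hT₀ hJD hT₀d h2 hT hTinv
    (weylDelta F E c v n hJD * nElem F E c v n hJD X hX)
  obtain ⟨-, hle⟩ := absDetDelta_le_one_of_weylDelta_mul_nElem_eq F E c hcδ hδ hd v n hT₀ hJD h2 X hX hp hk hg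
  have h0 := absDetDelta_nonneg F E c v n p
  rw [hg, hφ.apply_siegel_mul_localInt hp hk, localSiegelCharacter, norm_mul, norm_chiDet_eq_one F E c v n hχ1, one_mul]
  have hre : (s + (n : ℂ) / 2).re = s.re + (n : ℝ) / 2 := by simp
  rcases h0.eq_or_lt with h00 | hpos
  · -- degenerate value `|det_Δ p|_v = 0` (does not occur for Siegel `p`, but costs nothing)
    rw [← h00, Complex.ofReal_zero]
    by_cases hy : s + (n : ℂ) / 2 = 0
    · rw [hy, Complex.cpow_zero, norm_one]
    · rw [Complex.zero_cpow hy, norm_zero]; exact zero_le_one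
  · rw [Complex.norm_cpow_eq_rpow_re_of_pos hpos, hre]
    exact Real.rpow_le_one h0 hle hs

end Summit.HodgeConjecture.HodgeConjecture.Cruxes.HLiu418.K2LiuSiegelWeylUnipotentContent

end
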